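import Mathlib
import Literature.Computability.AlgebraicComplexity.ArithCircuitProofs
import Literature.Computability.AlgebraicComplexity.IMMInVPProofs
import Summits.ValiantsHypothesis.ValiantsHypothesis.Theorems.DivisionGapZeroOneTransferStubSqrtCheapAux1
import HarnessLib

/-!
# Crux `DivisionGap.ZeroOneTransfer` (stmt-ValiantsHypothesis-5066), line `charged-uncharged` —
registered stub `stub_sqrtCheap`: SQUARE ROOTS ARE CHEAP IN `VP` (unit base point)

**Claim settled** (stub B4 of the lead's skeleton, TRUE and classical): over `ℂ`, for the tree's
fan-in-two circuit complexity `L = complexity` (Bürgisser 2000, Def. 2.1),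
`f(0) = 1 ⟹ L(f) ≤ (L(f²) + deg f + #vars + 2)¹²` — `VP` is closed under square roots at a
unit base point (Bürgisser 2000, §2, closure properties of `VP`; a baby case of Kaltofen's
factor theorem).  The glue stub `stub_dimerFamilyVP` consumes this statement verbatim to pass
from `det K_n = D_n²` (Kasteleyn) to `D_n ∈ VP_ℂ`.

Proof (support file `…StubSqrtCheapAux1` holds the circuit-free algebra).  Put `u = f² - 1`
(constant term `0`, `L(u) ≤ L(f²) + 1`, `deg u ≤ 2d`, `d = deg f`) and let `T ∈ ℂ[Y]`, `deg T ≤ d`,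
`T(0) = 1`, `Y^{d+1} ∣ T² - (1+Y)` be the truncated square-root series
(`stub_sqrtCheap_sqrtSeries`).  Then `P = T(u) = Σ_{k ≤ d} T_k uᵏ` satisfies
`P² = f² + u^{d+1} · E(u)`, so `(P²)_i = (f²)_i` for `i ≤ d` (`uᵐ · R` has no component below
degree `m`), whence `P_i = f_i` for `i ≤ d` by uniqueness of square roots with constant term `1`,
and `f = Σ_{i ≤ d} P_i`.  Bookkeeping without sharing: `L(uᵏ) ≤ k (L(u) + 1)`,
`L(P) ≤ (d+1)(d(s+2)+2)` (`s = L(f²)`), `deg P ≤ 2d²`, and HOMOGENEOUS COMPONENTS ARE CHEAP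
(`complexity_homogeneousComponent_le`, by interpolation at the nodes `0, …, m` and the substitution
bound `complexity_aeval_le`): `L(Q_i) ≤ (m+1)(L(Q) + #vars + 2)` for `deg Q ≤ m`.  The resulting
bound `(d+1)(2d²+1)(L(P) + N + 2) + (d+1)` is `≤ X⁹ ≤ X¹²`, `X = s + d + N + 2` (`final_arith`).

Unconditional (axioms `propext`, `Classical.choice`, `Quot.sound`). References: [Burgisser2000]
Def. 2.1, §2; interpolation of homogeneous components is folklore (e.g. Strassen 1973).
-/

set_option linter.dupNamespace false

namespace Summit.ValiantsHypothesis.ValiantsHypothesis.Theorems.DivisionGapZeroOneTransfer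

namespace SqrtCheap

open MvPolynomial Literature.Computability.AlgebraicComplexity

section Complexity

variable {τ : Type}

/-- `L(0) = 0` (constants are free). [cite: Burgisser2000, Def. 2.1] -/
theorem complexity_zero_eq : complexity (0 : MvPolynomial τ ℂ) = 0 := by
  simpa using complexity_C_holds (σ := τ) (0 : ℂ)

/-- `L(1) = 0` (constants are free). [cite: Burgisser2000, Def. 2.1] -/
theorem complexity_one_eq : complexity (1 : MvPolynomial τ ℂ) = 0 := by
  simpa using complexity_C_holds (σ := τ) (1 : ℂ)

/-- Powers without sharing: `L(uᵏ) ≤ k (L(u) + 1)`. [cite: Burgisser2000, §2.1] -/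
theorem complexity_pow_le (u : MvPolynomial τ ℂ) (k : ℕ) :
    complexity (u ^ k) ≤ k * (complexity u + 1) := by
  induction k with
  | zero => rw [pow_zero, complexity_one_eq]; exact Nat.zero_le _
  | succ k ih =>
    rw [pow_succ]
    calc complexity (u ^ k * u) ≤ complexity (u ^ k) + complexity u + 1 :=
          complexity_mul_le_holds _ _
      _ ≤ k * (complexity u + 1) + complexity u + 1 := by omega
      _ = (k + 1) * (complexity u + 1) := by ring

variable [Fintype τ]

/-- The scaling substitution costs at most one gate per variable: `L(Q(t·x)) ≤ L(Q) + #vars`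
(substitution bound `complexity_aeval_le`, each `t · xⱼ` costing one gate).
[cite: Burgisser2000, Rem. 2.7] -/
theorem complexity_scale_le (t : ℂ) (Q : MvPolynomial τ ℂ) :
    complexity (aeval (fun x => C t * X x) Q) ≤ complexity Q + Fintype.card τ := by
  refine (complexity_aeval_le Q _).trans ?_
  have h : ∀ x : τ, complexity (C t * X x : MvPolynomial τ ℂ) ≤ 1 := fun x =>
    calc complexity (C t * X x : MvPolynomial τ ℂ)
        ≤ complexity (C t : MvPolynomial τ ℂ) + complexity (X x : MvPolynomial τ ℂ) + 1 :=
          complexity_mul_le_holds _ _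
      _ = 1 := by rw [complexity_C_holds, complexity_X_holds]
  have : ∑ x : τ, complexity (C t * X x : MvPolynomial τ ℂ) ≤ Fintype.card τ :=
    (Finset.sum_le_sum fun x _ => h x).trans (by simp)
  omega

/-- **Homogeneous components are cheap** (interpolation): if `deg Q ≤ m` then every homogeneous
component satisfies `L(Q_i) ≤ (m + 1) · (L(Q) + #vars + 2)` — `Q_i = Σ_{r ≤ m} w_r Q(r · x)` with
the dual weights of the nodes `0, …, m` (`SqrtCheap.homogeneousComponent_eq_sum_scale`), each
summand costing `≤ L(Q) + #vars + 1`; components above `m` are `0`. [folklore] -/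
theorem complexity_homogeneousComponent_le (Q : MvPolynomial τ ℂ) {m : ℕ}
    (hm : Q.totalDegree ≤ m) (i : ℕ) :
    complexity (homogeneousComponent i Q) ≤ (m + 1) * (complexity Q + Fintype.card τ + 2) := by
  by_cases hi : i ≤ m
  · obtain ⟨w, hw⟩ := exists_dualWeights m i
    rw [homogeneousComponent_eq_sum_scale Q hm hi hw]
    calc complexity (∑ r ∈ Finset.range (m + 1), w r • aeval (fun x => C (r : ℂ) * X x) Q)
        ≤ ∑ r ∈ Finset.range (m + 1), complexity (w r • aeval (fun x => C (r : ℂ) * X x) Q) +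
            (Finset.range (m + 1)).card := complexity_finset_sum_le _ _
      _ ≤ ∑ r ∈ Finset.range (m + 1), (complexity Q + Fintype.card τ + 1) +
            (Finset.range (m + 1)).card := by
          gcongr with r hr
          calc complexity (w r • aeval (fun x => C (r : ℂ) * X x) Q)
              ≤ complexity (aeval (fun x => C (r : ℂ) * X x) Q) + 1 :=
                complexity_smul_le_holds _ _
            _ ≤ complexity Q + Fintype.card τ + 1 := by
                have := complexity_scale_le (r : ℂ) Q
                omega
      _ = (m + 1) * (complexity Q + Fintype.card τ + 2) := by
          rw [Finset.sum_const, Finset.card_range, smul_eq_mul]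
          ring
  · rw [homogeneousComponent_eq_zero _ _ (by omega), complexity_zero_eq]
    exact Nat.zero_le _

end Complexity

/-- The final arithmetic: with `X = s + d + N + 2 (≥ 2)` and `L(P) ≤ (d+1)(d(s+2)+2) ≤ X³`,
`(d+1) · (2d²+1) · (L(P) + N + 2) + (d+1) ≤ X · X³ · X⁴ + X ≤ X⁹ ≤ X¹²`. [folklore] -/
theorem final_arith (s d N cP : ℕ) (hcP : cP ≤ (d + 1) * (d * (s + 2) + 2)) :
    (d + 1) * ((2 * d * d + 1) * (cP + N + 2)) + (d + 1) ≤ (s + d + N + 2) ^ 12 := by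
  set X := s + d + N + 2 with hX
  have hX2 : 2 ≤ X := by omega
  have h1 : d + 1 ≤ X := by omega
  have h2 : 2 * d * d + 1 ≤ X ^ 3 := by
    have e1 : (d + 1) * (d + 1) = d * d + 2 * d + 1 := by ring
    have e2 : 2 * d * d = 2 * (d * d) := by ring
    have e3 := Nat.mul_le_mul h1 h1
    calc 2 * d * d + 1 ≤ 2 * ((d + 1) * (d + 1)) := by omega
      _ ≤ 2 * (X * X) := by omega
      _ ≤ X * (X * X) := Nat.mul_le_mul_right _ hX2
      _ = X ^ 3 := by ring
  have h3 : d * (s + 2) + 2 ≤ X ^ 2 := by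
    have hd : d + 2 ≤ X := by omega
    have hs2 : s + 2 ≤ X := by omega
    calc d * (s + 2) + 2 ≤ (d + 2) * (s + 2) := by nlinarith
      _ ≤ X * X := Nat.mul_le_mul hd hs2
      _ = X ^ 2 := by ring
  have h4 : cP ≤ X ^ 3 :=
    hcP.trans ((Nat.mul_le_mul h1 h3).trans (le_of_eq (by ring)))
  have h5 : cP + N + 2 ≤ X ^ 4 := by
    have hN : N + 2 ≤ X := by omega
    have hXX : X ≤ X ^ 3 := Nat.le_self_pow (by norm_num) X
    calc cP + N + 2 ≤ X ^ 3 + X ^ 3 := by omega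
      _ = X ^ 3 * 2 := by ring
      _ ≤ X ^ 3 * X := Nat.mul_le_mul_left _ hX2
      _ = X ^ 4 := by ring
  have h6 : X ≤ X ^ 8 := Nat.le_self_pow (by norm_num) X
  calc (d + 1) * ((2 * d * d + 1) * (cP + N + 2)) + (d + 1)
      ≤ X * (X ^ 3 * X ^ 4) + X := by gcongr
    _ ≤ X ^ 8 + X ^ 8 := by
        have : X * (X ^ 3 * X ^ 4) = X ^ 8 := by ring
        omega
    _ = X ^ 8 * 2 := by ring
    _ ≤ X ^ 8 * X := Nat.mul_le_mul_left _ hX2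
    _ = X ^ 9 := by ring
    _ ≤ X ^ 12 := Nat.pow_le_pow_right (by omega) (by norm_num)

end SqrtCheap

open MvPolynomial SqrtCheap
open Literature.Computability.AlgebraicComplexity

/-- **Registered stub `stub_sqrtCheap`** (crux stmt-ValiantsHypothesis-5066, line `charged-uncharged`,
stub B4 of the skeleton): SQUARE ROOTS ARE CHEAP IN `VP` AT A UNIT BASE POINT.  Over `ℂ`, if
`f(0) = 1` then `L(f) ≤ (L(f²) + deg f + #vars + 2)¹²` for the tree's fan-in-two `complexity` `L`:
truncated square-root series `P = Σ_{k ≤ d} T_k (f² - 1)ᵏ` (`stub_sqrtCheap_sqrtSeries`),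
`P ≡ f` modulo degree `> d` by uniqueness of square roots with constant term `1`
(`SqrtCheap.homogeneousComponent_eq_of_sq`), `f = Σ_{i ≤ d} P_i`, and extraction of homogeneous
components by interpolation (`SqrtCheap.complexity_homogeneousComponent_le`).
[cite: Burgisser2000, §2 (closure properties of VP)] -/
theorem stub_sqrtCheap :
    ∀ (τ : Type) [Fintype τ] (f : MvPolynomial τ ℂ), MvPolynomial.constantCoeff f = 1 →
      complexity f ≤ (complexity (f ^ 2) + f.totalDegree + Fintype.card τ + 2) ^ 12 := by
  intro τ _ f hf
  set s := complexity (f ^ 2) with hs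
  set d := f.totalDegree with hd
  set N := Fintype.card τ with hN
  -- the polynomial `u = f² - 1` with zero constant term
  set u : MvPolynomial τ ℂ := f ^ 2 + C (-1) with hu
  have hu0 : constantCoeff u = 0 := by
    rw [hu, map_add, map_pow, constantCoeff_C, hf]
    norm_num
  have h1u : f * f = 1 + u := by
    rw [hu, C_neg, C_1]
    ring
  have hcu : complexity u ≤ s + 1 := by
    calc complexity u ≤ complexity (f ^ 2) + complexity (C (-1) : MvPolynomial τ ℂ) + 1 :=
          complexity_add_le_holds _ _
      _ = s + 1 := by rw [complexity_C_holds]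
  have hdu : u.totalDegree ≤ 2 * d := by
    calc u.totalDegree ≤ max (f ^ 2).totalDegree (C (-1 : ℂ) : MvPolynomial τ ℂ).totalDegree :=
          totalDegree_add _ _
      _ ≤ 2 * d := by
          rw [totalDegree_C, Nat.max_zero]
          exact totalDegree_pow _ _
  -- the truncated square-root series `T` and `P = T(u)`
  obtain ⟨T, hTdeg, hT0, E, hE⟩ := stub_sqrtCheap_sqrtSeries d
  set P : MvPolynomial τ ℂ := Polynomial.aeval u T with hP
  have hPsum : P = ∑ k ∈ Finset.range (d + 1), T.coeff k • u ^ k :=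
    Polynomial.aeval_eq_sum_range' hTdeg u
  -- `P² ≡ f²` and hence `P ≡ f` modulo degree `> d`
  have hPP : P * P = f * f + u ^ (d + 1) * Polynomial.aeval u E := by
    have h := congrArg (Polynomial.aeval u) hE
    simp only [map_sub, map_pow, map_add, map_one, map_mul, Polynomial.aeval_X] at h
    rw [h1u]
    linear_combination h
  have hP0 : homogeneousComponent 0 P = 1 := by
    rw [homogeneousComponent_zero, ← constantCoeff_eq, hPsum, map_sum]
    simp_rw [smul_eq_C_mul, map_mul, constantCoeff_C, map_pow, hu0]
    simp [Finset.sum_range_succ', hT0]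
  have hf0 : homogeneousComponent 0 f = 1 := by
    rw [homogeneousComponent_zero, ← constantCoeff_eq, hf, C_1]
  have hcomp : ∀ i ≤ d, homogeneousComponent i P = homogeneousComponent i f :=
    homogeneousComponent_eq_of_sq d hP0 hf0 fun i hi => by
      rw [hPP, map_add, homogeneousComponent_pow_mul_eq_zero hu0 (d + 1) _ i (by omega), add_zero]
  have hfsum : f = ∑ i ∈ Finset.range (d + 1), homogeneousComponent i P := by
    conv_lhs => rw [← sum_homogeneousComponent f]
    exact Finset.sum_congr rfl fun i hi =>
      (hcomp i (by have := Finset.mem_range.mp hi; omega)).symm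
  -- bookkeeping: `L(P)` and `deg P`
  have hcP : complexity P ≤ (d + 1) * (d * (s + 2) + 2) := by
    rw [hPsum]
    calc complexity (∑ k ∈ Finset.range (d + 1), T.coeff k • u ^ k)
        ≤ ∑ k ∈ Finset.range (d + 1), complexity (T.coeff k • u ^ k) +
            (Finset.range (d + 1)).card := complexity_finset_sum_le _ _
      _ ≤ ∑ k ∈ Finset.range (d + 1), (d * (s + 2) + 1) + (Finset.range (d + 1)).card := by
          gcongr with k hk
          have hk' : k ≤ d := by have := Finset.mem_range.mp hk; omega
          calc complexity (T.coeff k • u ^ k) ≤ complexity (u ^ k) + 1 :=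
                complexity_smul_le_holds _ _
            _ ≤ k * (complexity u + 1) + 1 := by
                have := complexity_pow_le u k
                omega
            _ ≤ d * (s + 2) + 1 := by
                have : k * (complexity u + 1) ≤ d * (s + 2) := Nat.mul_le_mul hk' (by omega)
                omega
      _ = (d + 1) * (d * (s + 2) + 2) := by
          rw [Finset.sum_const, Finset.card_range, smul_eq_mul]
          ring
  have hdP : P.totalDegree ≤ 2 * d * d := by
    rw [hPsum]
    refine totalDegree_finsetSum_le fun k hk => ?_
    have hk' : k ≤ d := by have := Finset.mem_range.mp hk; omega
    calc (T.coeff k • u ^ k).totalDegree ≤ (u ^ k).totalDegree := totalDegree_smul_le _ _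
      _ ≤ k * u.totalDegree := totalDegree_pow _ _
      _ ≤ d * (2 * d) := Nat.mul_le_mul hk' hdu
      _ = 2 * d * d := by ring
  -- assembly: `f = Σ_{i ≤ d} P_i`, each component by interpolation
  calc complexity f = complexity (∑ i ∈ Finset.range (d + 1), homogeneousComponent i P) := by
        rw [← hfsum]
    _ ≤ ∑ i ∈ Finset.range (d + 1), complexity (homogeneousComponent i P) +
          (Finset.range (d + 1)).card := complexity_finset_sum_le _ _
    _ ≤ ∑ i ∈ Finset.range (d + 1), (2 * d * d + 1) * (complexity P + N + 2) +
          (Finset.range (d + 1)).card := by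
        gcongr with i hi
        exact complexity_homogeneousComponent_le P hdP i
    _ = (d + 1) * ((2 * d * d + 1) * (complexity P + N + 2)) + (d + 1) := by
        rw [Finset.sum_const, Finset.card_range, smul_eq_mul]
    _ ≤ (s + d + N + 2) ^ 12 := final_arith s d N (complexity P) hcP

end Summit.ValiantsHypothesis.ValiantsHypothesis.Theorems.DivisionGapZeroOneTransfer
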